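import Summits.QuantumFields.YangMills.Theorems.IR.PressureMonotoneTMLogFloor
import Literature.MathematicalPhysics.QuantumFieldTheory.LatticeGaugeProofs
import Literature.MathematicalPhysics.QuantumFieldTheory.TorusFreeTransfer

/-!
# Pressure-monotone-TM supplier, file 4∕4: equipartition ⟺ free-energy increments (Jensen ∕ Peierls–Bogoliubov), unconditional uniform equipartition
# above the log floor, and weak equipartition on ALL tori

Landed for item `stmt-QuantumFields-19354` (`--supports … --as helper`) by the LEAD prover ab-p1 under director-ym RULING g9-№2 ∕ №14 (3)
(critic ym-ir-crit-2 03:04:13Z ∕ 03:14:37Z: PASS as supplier); authored by ideator ym-ir-idea-5 g7, split of the sorry-free workfile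
`Cruxes/IR/Lines/pressure_monotone_tm.lean` v5 (Part B = `Cruxes/IR/Lines/rp_doubling.lean`) per `Cruxes/IR/Lines/pressure_monotone_tm_LANDING.md`
(eight files: `SiteRPGeometry` → `SiteRPDoubling` → `SiteRPZdBoxes` → `SiteRPFreeCubeDoubling`; `PressureMonotoneTMFloor` → `…LinearFloor` → `…LogFloor` → `…Equipartition`).

Content (§7–§9): `toReal_partitionFunction_eq_integral`, `wilsonExpectation_exp_mul_wilsonAction`, ★ `sub_mul_wilsonExpectation_wilsonAction_le` (two-point Jensen, every `d`, `G`,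
continuous `ρ`), `UniformEquipartitionFrom`, `uniformEquipartitionFrom_iff_freeEnergyIncrementFrom` (monotone floors), ★ `uniformEquipartitionFrom_logFloor_holds` (no hypothesis),
`freeEnergyIncrementFrom_two_iff`, `torusLogPartition_zero`, `weak_equipartition_of_tendsto`, ★ `weak_equipartition_holds` (`β⟨S⟩ ≤ L⁴(c log β + C)` ∀ `L ≥ 2`).

HONESTY.  Supplier ∕ kinematic content only (holds for `U(1)` too): nothing here proves the Yang–Mills mass gap (Clay), `BalabanLadder.IR`,
`BalabanLadder.NT` or a lattice gap; R4 closes only the conditional finite-𝕋⁴ rung `BalabanLadder.UV`.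
-/

noncomputable section

namespace Summit.QuantumFields.YangMills.Cruxes.IR.PressureMonotoneTM

open Summit.QuantumFields.YangMills.Cruxes.IR.LargeFieldRarityChessboard (FreeEnergyIncrementFrom)

open scoped Topology
open MeasureTheory Filter Finset
open Literature.MathematicalPhysics.QuantumFieldTheory Literature.MathematicalPhysics.QuantumLattice

/-! ## §7 Equipartition ⟺ free-energy increments (Jensen / Peierls–Bogoliubov)

`log Z_{Λ_L}(·)` is convex with derivative `−⟨S⟩_{Λ_L,·}`; the derivative-free form used here is the two-point JENSEN inequality
`(b − a)·⟨S⟩_{Λ_L,b} ≤ log Z_{Λ_L}(a) − log Z_{Λ_L}(b)` (all real `a, b`; `⟨e^{(b−a)S}⟩_b = Z(a)/Z(b)` and `log E e^X ≥ E X`).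
Consequences: UNIFORM EQUIPARTITION above a volume floor `fl` (`β·⟨S⟩_{Λ_L,β} ≤ c·L⁴` for `L ≥ fl β`, `β ≥ β₃`) and the
free-energy increment bound (FE) above `fl` are EQUIVALENT up to constants (dyadic chain one way, `a = β/2` the other).  With §6
this gives unconditional uniform equipartition above the log floor `⌈log β⌉₊ + 2`; and idea-4's floor-free residual (FE below
`log β`, D-0146 R<) is thereby the same statement as TINY-TORUS EQUIPARTITION `sup_{L ≤ log β} β⟨S⟩_{Λ_L,β}/L⁴ < ∞` — the toron
question (instrument row: `t·⟨S⟩_{Λ_L,t}/L⁴` at `L ∈ {2,3,4}`, `t ∈ {8,32,128}`, eng request 2026-08-28T04:12Z). -/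

section Equipartition

variable {d N : ℕ} {G : Type*} [Group G] [TopologicalSpace G] [IsTopologicalGroup G] [CompactSpace G]
  [MeasurableSpace G] [BorelSpace G] [SecondCountableTopology G]

/-- `Z_{Λ_L,β} = ∫ e^{−β S} dHaar^{links}` as a real number. -/
theorem toReal_partitionFunction_eq_integral (ρ : G →* Matrix (Fin N) (Fin N) ℂ) (hρ : Continuous ρ)
    {L : ℕ} [NeZero L] (β : ℝ) :
    (partitionFunction (d := d) (L := L) ρ β).toReal =
      ∫ U, Real.exp (-β * wilsonAction ρ U) ∂Measure.pi fun _ : Edge d L => haarProbability G := by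
  rw [FreeEnergy.partitionFunction_eq_ofReal_integral ρ hρ β,
    ENNReal.toReal_ofReal (integral_nonneg fun U => Finset.prod_nonneg fun _ _ => (Real.exp_pos _).le)]
  simp_rw [FreeEnergy.exp_neg_mul_wilsonAction ρ β]

/-- `0 < ∫ e^{c·S(U)} dHaar^{links}` (the integrand is positive and continuous on a compact configuration space). -/
theorem integral_exp_mul_wilsonAction_pos (ρ : G →* Matrix (Fin N) (Fin N) ℂ) (hρ : Continuous ρ)
    {L : ℕ} [NeZero L] (c : ℝ) :
    0 < ∫ U, Real.exp (c * wilsonAction ρ U) ∂Measure.pi fun _ : Edge d L => haarProbability G :=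
  integral_exp_pos ((Real.continuous_exp.comp (continuous_const.mul (continuous_wilsonAction (ρ := ρ) hρ))
    ).integrable_of_hasCompactSupport (HasCompactSupport.of_compactSpace _))

/-- `⟨e^{c S}⟩_{Λ_L,b} = Z(b − c)/Z(b)` … stated for `c = b − a`: `⟨e^{(b−a)S}⟩_b = Z(a)/Z(b)`. -/
theorem wilsonExpectation_exp_mul_wilsonAction (ρ : G →* Matrix (Fin N) (Fin N) ℂ) (hρ : Continuous ρ)
    {L : ℕ} [NeZero L] (a b : ℝ) :
    wilsonExpectation (d := d) (L := L) ρ b (fun U => Real.exp ((b - a) * wilsonAction ρ U)) =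
      (∫ U, Real.exp (-a * wilsonAction ρ U) ∂Measure.pi fun _ : Edge d L => haarProbability G) /
        ∫ U, Real.exp (-b * wilsonAction ρ U) ∂Measure.pi fun _ : Edge d L => haarProbability G := by
  have hw : Measurable fun U : GaugeConfig d L G => ENNReal.ofReal (Real.exp (-b * wilsonAction ρ U)) :=
    (Real.measurable_exp.comp ((measurable_wilsonAction ρ hρ).const_mul _)).ennreal_ofReal
  simp only [wilsonExpectation, wilsonMeasure, integral_smul_measure, wilsonWeight]
  rw [integral_withDensity_eq_integral_toReal_smul hw (ae_of_all _ fun _ => ENNReal.ofReal_lt_top)]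
  have h1 : (fun U : GaugeConfig d L G => (ENNReal.ofReal (Real.exp (-b * wilsonAction ρ U))).toReal •
      Real.exp ((b - a) * wilsonAction ρ U)) = fun U => Real.exp (-a * wilsonAction ρ U) := by
    funext U
    rw [ENNReal.toReal_ofReal (Real.exp_pos _).le, smul_eq_mul, ← Real.exp_add]
    congr 1; ring
  rw [h1, ENNReal.toReal_inv, toReal_partitionFunction_eq_integral ρ hρ b, smul_eq_mul, div_eq_inv_mul]

/-- **Jensen / Peierls–Bogoliubov for the Wilson torus pressure**: `(b − a)·⟨S⟩_{Λ_L,b} ≤ log Z_{Λ_L}(a) − log Z_{Λ_L}(b)` for all real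
`a, b` (every `d`, every compact second-countable `G`, continuous `ρ`). [folklore: convexity of the pressure] -/
theorem sub_mul_wilsonExpectation_wilsonAction_le (ρ : G →* Matrix (Fin N) (Fin N) ℂ) (hρ : Continuous ρ)
    {L : ℕ} [NeZero L] (a b : ℝ) :
    (b - a) * wilsonExpectation (d := d) (L := L) ρ b (wilsonAction ρ) ≤
      torusLogPartition d ρ a L - torusLogPartition d ρ b L := by
  haveI : IsProbabilityMeasure (wilsonMeasure (d := d) (L := L) ρ b) := isProbabilityMeasure_wilsonMeasure ρ hρ b
  have hSc : Continuous (wilsonAction (d := d) (L := L) ρ) := continuous_wilsonAction (ρ := ρ) hρ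
  have hgi : Integrable (fun U => (b - a) * wilsonAction ρ U) (wilsonMeasure (d := d) (L := L) ρ b) :=
    (continuous_const.mul hSc).integrable_of_hasCompactSupport (HasCompactSupport.of_compactSpace _)
  have hegi : Integrable (Real.exp ∘ fun U => (b - a) * wilsonAction ρ U) (wilsonMeasure (d := d) (L := L) ρ b) :=
    (Real.continuous_exp.comp (continuous_const.mul hSc)).integrable_of_hasCompactSupport
      (HasCompactSupport.of_compactSpace _)
  have hJ := ConvexOn.map_integral_le (μ := wilsonMeasure (d := d) (L := L) ρ b)
    (f := fun U => (b - a) * wilsonAction ρ U) (g := Real.exp) (s := Set.univ) convexOn_exp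
    Real.continuous_exp.continuousOn isClosed_univ (ae_of_all _ fun _ => Set.mem_univ _) hgi hegi
  have hlhs : (∫ U, (b - a) * wilsonAction ρ U ∂wilsonMeasure (d := d) (L := L) ρ b) =
      (b - a) * wilsonExpectation (d := d) (L := L) ρ b (wilsonAction ρ) := by
    rw [integral_const_mul]; rfl
  have hE := wilsonExpectation_exp_mul_wilsonAction (d := d) ρ hρ (L := L) a b
  unfold wilsonExpectation at hE
  rw [hlhs, hE] at hJ
  have hpos := div_pos (integral_exp_mul_wilsonAction_pos (d := d) ρ hρ (L := L) (-a))
    (integral_exp_mul_wilsonAction_pos (d := d) ρ hρ (L := L) (-b))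
  rw [← Real.le_log_iff_exp_le hpos, Real.log_div (integral_exp_mul_wilsonAction_pos (d := d) ρ hρ (-a)).ne'
    (integral_exp_mul_wilsonAction_pos (d := d) ρ hρ (-b)).ne'] at hJ
  simpa only [torusLogPartition, toReal_partitionFunction_eq_integral ρ hρ] using hJ

end Equipartition

section EquipartitionFE

open scoped Classical

/-- **Uniform equipartition above the volume floor `fl`** (typed here): for every compact simple `G` and lattice representation `r`
there are `c, β₃` with `β · ⟨S⟩_{Λ_L,β} ≤ c · L⁴` for all `β ≥ β₃` and all tori `L ≥ fl β` (`S` = total Wilson action, `6L⁴`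
plaquettes: energy `O(1/β)` per plaquette, uniformly in the volume above the floor). -/
def UniformEquipartitionFrom (fl : ℝ → ℕ) : Prop :=
  ∀ (G : Type) [Group G] [TopologicalSpace G] [IsTopologicalGroup G] [CompactSpace G],
    IsCompactSimpleLieGroup G →
    letI : MeasurableSpace G := borel G
    haveI : BorelSpace G := ⟨rfl⟩
    ∀ (r : LatticeRep G), ∃ (c β₃ : ℝ), 0 < β₃ ∧
      ∀ (L : ℕ) [NeZero L] (β : ℝ), β₃ ≤ β → fl β ≤ L →
        β * wilsonExpectation (d := 4) (L := L) r.ρ β (wilsonAction r.ρ) ≤ c * (L : ℝ) ^ 4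

/-- (FE) ⇒ uniform equipartition, same floor (Jensen at `a = β/2`). -/
theorem uniformEquipartitionFrom_of_freeEnergyIncrementFrom {fl : ℝ → ℕ} (h : FreeEnergyIncrementFrom fl) :
    UniformEquipartitionFrom fl := by
  intro G _ _ _ _ hG
  letI : MeasurableSpace G := borel G
  haveI : BorelSpace G := ⟨rfl⟩
  intro r
  obtain ⟨ν₀, C, β₃, hβ₃, hF⟩ := h G hG r
  haveI : SecondCountableTopology G :=
    (r.continuous.isClosedEmbedding r.injective).isEmbedding.secondCountableTopology
  refine ⟨2 * (ν₀ * Real.log 2 + C), 2 * β₃, by linarith, fun L _ β hβ hL => ?_⟩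
  have hJ := sub_mul_wilsonExpectation_wilsonAction_le (d := 4) r.ρ r.continuous (L := L) (β / 2) β
  have hF' := hF L (β / 2) β (by linarith) (by linarith) hL
  have hβ0 : β ≠ 0 := by intro h0; rw [h0] at hβ; linarith
  have h2 : β / (β / 2) = 2 := by field_simp
  rw [h2] at hF'
  have h3 : (β - β / 2) = β / 2 := by ring
  rw [h3] at hJ
  nlinarith [hJ, hF']

/-- Uniform equipartition ⇒ (FE), same (monotone) floor: dyadic chain of Jensen steps `log Z(t) − log Z(β) ≤ (β − t)⟨S⟩_t ≤ t⟨S⟩_t`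
(`t ≤ β ≤ 2t`), `⌈log₂(β/β')⌉` steps. -/
theorem freeEnergyIncrementFrom_of_uniformEquipartitionFrom {fl : ℝ → ℕ} (hfl : ∀ s t : ℝ, s ≤ t → fl s ≤ fl t)
    (h : UniformEquipartitionFrom fl) : FreeEnergyIncrementFrom fl := by
  intro G _ _ _ _ hG
  letI : MeasurableSpace G := borel G
  haveI : BorelSpace G := ⟨rfl⟩
  intro r
  obtain ⟨c, β₃, hβ₃, hc⟩ := h G hG r
  haveI : SecondCountableTopology G :=
    (r.continuous.isClosedEmbedding r.injective).isEmbedding.secondCountableTopology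
  have hρN : ∀ g, (r.ρ g).trace.re ≤ (r.N : ℝ) := fun g => by
    have := Literature.RepresentationTheory.CompactGroups.CompactGroup.abs_re_trace_le_card r.ρ r.continuous g
    simp only [Fintype.card_fin] at this
    exact (abs_le.1 this).2
  have hS0 : ∀ (L : ℕ) [NeZero L] (t : ℝ), 0 ≤ wilsonExpectation (d := 4) (L := L) r.ρ t (wilsonAction r.ρ) := by
    intro L _ t
    unfold wilsonExpectation
    refine integral_nonneg fun U => ?_
    unfold wilsonAction
    exact Finset.sum_nonneg fun p _ => by linarith [hρN (plaquetteHolonomy U p.1 p.2.1.1 p.2.1.2)]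
  set c' := max c 0 with hc'
  have hc'0 : 0 ≤ c' := le_max_right _ _
  have step : ∀ (L : ℕ) [NeZero L] (t β : ℝ), β₃ ≤ t → t ≤ β → β ≤ 2 * t → fl β ≤ L →
      torusLogPartition 4 r.ρ t L - torusLogPartition 4 r.ρ β L ≤ c' * (L : ℝ) ^ 4 := by
    intro L _ t β ht htβ hβ2 hL
    have hJ := sub_mul_wilsonExpectation_wilsonAction_le (d := 4) r.ρ r.continuous (L := L) β t
    have hE := hc L t ht (le_trans (hfl t β htβ) hL)
    have h0 := hS0 L t
    have h1 : (β - t) * wilsonExpectation (d := 4) (L := L) r.ρ t (wilsonAction r.ρ) ≤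
        t * wilsonExpectation (d := 4) (L := L) r.ρ t (wilsonAction r.ρ) :=
      mul_le_mul_of_nonneg_right (by linarith) h0
    have hcL : c * (L : ℝ) ^ 4 ≤ c' * (L : ℝ) ^ 4 := mul_le_mul_of_nonneg_right (le_max_left _ _) (by positivity)
    linarith
  have chain : ∀ (n : ℕ) (L : ℕ) [NeZero L] (β' β : ℝ), β₃ ≤ β' → β' ≤ β → β ≤ 2 ^ n * β' → fl β ≤ L →
      torusLogPartition 4 r.ρ β' L - torusLogPartition 4 r.ρ β L ≤ n * (c' * (L : ℝ) ^ 4) := by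
    intro n
    induction n with
    | zero =>
      intro L _ β' β h3 h1 h2 hL
      have h : β = β' := le_antisymm (by simpa using h2) h1
      subst h
      simp
    | succ n ih =>
      intro L _ β' β h3 h1 h2 hL
      have hβ'0 : 0 < β' := lt_of_lt_of_le hβ₃ h3
      set t := max β' (β / 2) with ht
      have ht1 : β' ≤ t := le_max_left _ _
      have ht2 : t ≤ 2 ^ n * β' := by
        refine max_le (le_mul_of_one_le_left hβ'0.le (one_le_pow₀ (by norm_num))) ?_
        rw [pow_succ] at h2
        linarith
      have ht3 : t ≤ β := max_le h1 (by linarith)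
      have ht4 : β ≤ 2 * t := by
        rcases le_total β' (β / 2) with h | h
        · rw [ht, max_eq_right h]; linarith
        · rw [ht, max_eq_left h]; linarith
      have hflt : fl t ≤ L := le_trans (hfl t β ht3) hL
      have i1 := ih L β' t h3 ht1 ht2 hflt
      have i2 := step L t β (le_trans h3 ht1) ht3 ht4 hL
      push_cast
      linarith
  refine ⟨c' / Real.log 2, c', β₃, hβ₃, fun L _ β' β h3 h1 hL => ?_⟩
  have hβ'0 : 0 < β' := lt_of_lt_of_le hβ₃ h3
  have hlog2 : 0 < Real.log 2 := Real.log_pos one_lt_two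
  have hr1 : 1 ≤ β / β' := by rw [le_div_iff₀ hβ'0]; linarith
  set x := Real.log (β / β') / Real.log 2 with hx
  have hx0 : 0 ≤ x := div_nonneg (Real.log_nonneg hr1) hlog2.le
  have hn : (⌈x⌉₊ : ℝ) < x + 1 := Nat.ceil_lt_add_one hx0
  have hpow : β ≤ 2 ^ ⌈x⌉₊ * β' := by
    have hxl : Real.log (β / β') ≤ (⌈x⌉₊ : ℝ) * Real.log 2 := by
      have := Nat.le_ceil x
      rw [hx, div_le_iff₀ hlog2] at this
      exact this
    have h2x : β / β' ≤ (2 : ℝ) ^ ⌈x⌉₊ := by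
      calc β / β' = Real.exp (Real.log (β / β')) := (Real.exp_log (by positivity)).symm
        _ ≤ Real.exp ((⌈x⌉₊ : ℝ) * Real.log 2) := Real.exp_le_exp.2 hxl
        _ = (2 : ℝ) ^ ⌈x⌉₊ := by rw [← Real.rpow_natCast, Real.rpow_def_of_pos two_pos, mul_comm]
    rwa [div_le_iff₀ hβ'0] at h2x
  have hch := chain ⌈x⌉₊ L β' β h3 h1 hpow hL
  have hL4 : 0 ≤ c' * (L : ℝ) ^ 4 := by positivity
  have hm : (⌈x⌉₊ : ℝ) * (c' * (L : ℝ) ^ 4) ≤ (x + 1) * (c' * (L : ℝ) ^ 4) := mul_le_mul_of_nonneg_right hn.le hL4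
  have hxe : x * (c' * (L : ℝ) ^ 4) = c' / Real.log 2 * (L : ℝ) ^ 4 * Real.log (β / β') := by
    rw [hx]; ring
  linarith

/-- The two typed statements are equivalent for monotone floors (up to the constants hidden in the `∃`). -/
theorem uniformEquipartitionFrom_iff_freeEnergyIncrementFrom {fl : ℝ → ℕ} (hfl : ∀ s t : ℝ, s ≤ t → fl s ≤ fl t) :
    UniformEquipartitionFrom fl ↔ FreeEnergyIncrementFrom fl :=
  ⟨freeEnergyIncrementFrom_of_uniformEquipartitionFrom hfl, uniformEquipartitionFrom_of_freeEnergyIncrementFrom⟩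

end EquipartitionFE

/-! ## §8 The hook, continued: UNCONDITIONAL uniform equipartition above the log floor

`β·⟨S⟩_{Λ_L,β} ≤ c·L⁴` for all `β ≥ β₃` and all tori `L ≥ ⌈log β⌉₊ + 2`, every compact simple `G` and lattice representation `r`
(from §6 `freeEnergyIncrementFrom_logFloor_holds` by Jensen at `a = β/2`).  Below the log floor this is OPEN (torons) and is, by
`uniformEquipartitionFrom_iff_freeEnergyIncrementFrom`, exactly idea-4's floor-free residual. -/

/-- **UNCONDITIONAL uniform equipartition above the log floor**: `UniformEquipartitionFrom logFloor` (from `freeEnergyIncrementFrom_logFloor_holds` and §7). -/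
theorem uniformEquipartitionFrom_logFloor_holds : UniformEquipartitionFrom logFloor :=
  uniformEquipartitionFrom_of_freeEnergyIncrementFrom freeEnergyIncrementFrom_logFloor_holds

/-- idea-4's (FE) holds FLOOR-FREE (all tori `L ≥ 2`… as typed: `L ≥ 2` via the constant floor) iff uniform equipartition holds on
all tori — the typed form of «the residual R< is tiny-torus equipartition». -/
theorem freeEnergyIncrementFrom_two_iff : FreeEnergyIncrementFrom (fun _ => 2) ↔ UniformEquipartitionFrom (fun _ => 2) :=
  (uniformEquipartitionFrom_iff_freeEnergyIncrementFrom (fl := fun _ => 2) fun _ _ _ => le_rfl).symm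

/-! ## §9 Weak equipartition on ALL tori (β-nonuniform by `log β`): the size of the floor-free residual

Jensen at `a = 0` (`Z_{Λ_L}(0) = 1`) and the β-uniform sharp floor of §3 give, with Chatterjee's `f(β) + (3 dim G/2) log β → K`
(`freeEnergyLogCoefficient_proof`), `β·⟨S⟩_{Λ_L,β} ≤ L⁴·(c log β + C)` for ALL tori `L ≥ 2` and `β ≥ β₃` — PROVED.  The floor-free
residual (§8, `freeEnergyIncrementFrom_two_iff`) asks to remove the factor `log β` on the tori `2 ≤ L ≤ ⌈log β⌉₊ + 1` (§8 removes it
above); this is the same exponent gap as the torus excess `log Z_L − L⁴f ≍ κ_L log β` (torons, memo N20), and it is OPEN. -/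

section WeakEquipartition

open scoped Topology
open MeasureTheory Filter Finset
open Literature.MathematicalPhysics.QuantumFieldTheory Literature.MathematicalPhysics.QuantumLattice

variable {d N : ℕ} {G : Type*} [Group G] [TopologicalSpace G] [IsTopologicalGroup G] [CompactSpace G]
  [MeasurableSpace G] [BorelSpace G] [SecondCountableTopology G]

/-- `log Z_{Λ_L}(0) = 0` (Haar probability). -/
theorem torusLogPartition_zero (ρ : G →* Matrix (Fin N) (Fin N) ℂ) (hρ : Continuous ρ) {L : ℕ} [NeZero L] :
    torusLogPartition d ρ 0 L = 0 := by
  rw [torusLogPartition, toReal_partitionFunction_eq_integral ρ hρ]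
  simp

/-- Jensen at `a = 0`: `β·⟨S⟩_{Λ_L,β} ≤ −log Z_{Λ_L}(β)`. -/
theorem mul_wilsonExpectation_wilsonAction_le_neg_torusLogPartition (ρ : G →* Matrix (Fin N) (Fin N) ℂ)
    (hρ : Continuous ρ) {L : ℕ} [NeZero L] (β : ℝ) :
    β * wilsonExpectation (d := d) (L := L) ρ β (wilsonAction ρ) ≤ -torusLogPartition d ρ β L := by
  have h := sub_mul_wilsonExpectation_wilsonAction_le (d := d) ρ hρ (L := L) 0 β
  rw [torusLogPartition_zero ρ hρ, sub_zero, zero_sub] at h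
  exact h

end WeakEquipartition

section WeakEquipartitionWilson

open scoped Topology Classical
open MeasureTheory Filter Finset
open Literature.MathematicalPhysics.QuantumFieldTheory Literature.MathematicalPhysics.QuantumLattice

variable {G : Type} [Group G] [TopologicalSpace G] [IsTopologicalGroup G] [CompactSpace G]
  [MeasurableSpace G] [BorelSpace G]

/-- **Weak equipartition on all tori** from any asymptotics `f(β) + c log β → K`: eventually in `β`, for every torus `L ≥ 2`,
`β·⟨S⟩_{Λ_L,β} ≤ L⁴·(c log β + (1 − K))`. -/
theorem weak_equipartition_of_tendsto (r : LatticeRep G) {c K : ℝ}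
    (hK : Tendsto (fun β : ℝ => freeEnergyDensity 4 r.ρ β + c * Real.log β) atTop (𝓝 K)) :
    ∀ᶠ β : ℝ in atTop, ∀ (L : ℕ) [NeZero L], 2 ≤ L →
      β * wilsonExpectation (d := 4) (L := L) r.ρ β (wilsonAction r.ρ) ≤ (L : ℝ) ^ 4 * (c * Real.log β + (1 - K)) := by
  haveI : SecondCountableTopology G :=
    (r.continuous.isClosedEmbedding r.injective).isEmbedding.secondCountableTopology
  filter_upwards [uniform_floor_of_tendsto r hK one_pos] with β hβ L _ hL
  have h1 := mul_wilsonExpectation_wilsonAction_le_neg_torusLogPartition (d := 4) r.ρ r.continuous (L := L) β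
  have h2 := hβ L hL
  have h3 : (L : ℝ) ^ 4 * (K - 1 - c * Real.log β) = -((L : ℝ) ^ 4 * (c * Real.log β + (1 - K))) := by ring
  linarith

/-- **Weak equipartition, unconditional** (every compact simple `G`, every lattice representation): there are `c, C, β₃` with
`β·⟨S⟩_{Λ_L,β} ≤ L⁴·(c log β + C)` for all `β ≥ β₃` and ALL tori `L ≥ 2` (`c = 3 dim G / 2` from Chatterjee's theorem). -/
theorem weak_equipartition_holds :
    ∀ (G : Type) [Group G] [TopologicalSpace G] [IsTopologicalGroup G] [CompactSpace G],
      IsCompactSimpleLieGroup G →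
      letI : MeasurableSpace G := borel G
      haveI : BorelSpace G := ⟨rfl⟩
      ∀ (r : LatticeRep G), ∃ (c C β₃ : ℝ), ∀ (β : ℝ), β₃ ≤ β → ∀ (L : ℕ) [NeZero L], 2 ≤ L →
        β * wilsonExpectation (d := 4) (L := L) r.ρ β (wilsonAction r.ρ) ≤ (L : ℝ) ^ 4 * (c * Real.log β + C) := by
  intro G _ _ _ _ hG
  letI : MeasurableSpace G := borel G
  haveI : BorelSpace G := ⟨rfl⟩
  intro r
  obtain ⟨K, hK⟩ := Summit.QuantumFields.YangMills.Theorems.freeEnergyLogCoefficient_proof G hG r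
  obtain ⟨β₃, hβ₃⟩ := Filter.eventually_atTop.1 (weak_equipartition_of_tendsto r hK)
  exact ⟨_, 1 - K, β₃, fun β hβ L _ hL => hβ₃ β hβ L hL⟩

end WeakEquipartitionWilson

end Summit.QuantumFields.YangMills.Cruxes.IR.PressureMonotoneTM

end
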